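import Literature.Geometry.Lorentzian.InducedVacuumData
import Literature.Geometry.Lorentzian.KerrRicciFlat
import Literature.Geometry.Lorentzian.KerrSliceFacts
import HarnessLib

/-!
# The Kerr–Schild slice data solve the vacuum constraint equations (all spins)

Discharge of the named fact `Kerr.data_isVacuumConstraintSolution` (`KerrData.lean`, statement
**gr.S17**): for every mass `M ≥ 0`, every specific angular momentum `a` and every inner radius `r₀`,
the initial data set `Kerr.data M a r₀ hM = (h, k)` induced by the Kerr metric `g = η + 2H ℓ ⊗ ℓ` on
the Kerr–Schild slice `{t* = 0} ∩ {r > max r₀ 0}` satisfies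
`R(h) − |k|²_h + (tr_h k)² = 0` and `div_h k − d(tr_h k) = 0`.

This is Choquet-Bruhat 2009, Ch. VI, Thm. 3.3 (the constraints are necessary: twice-traced Gauss
and traced Codazzi equations on a spacelike hypersurface of a vacuum spacetime), in the tree as
`InitialDataSet.isVacuumConstraintSolution_of_eq_induced` (`InducedVacuumData.lean`), applied to the
slice embedding `y ↦ (0, y)` (a smooth spacelike immersion, `Kerr.isSpacelikeImmersion_sliceEmbed_holds`)
with its future unit normal `ν = (1 + 2H)^{-1/2} V` (`Kerr.isFutureUnitNormal_sliceNormal_holds`,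
smooth lift `Kerr.contMDiff_sliceNormal_lift`) into the Kerr–Schild chart, which is **vacuum for
every spin** (`Kerr.ricci_smoothMetric`, `KerrRicciFlat.lean`: Kerr–Schild 1965, §3). The `a = 0`
instance was proved earlier from the closed-form Schwarzschild data
(`Kerr.data_isVacuumConstraintSolution_zero`, `KerrDataSchwarzschildConstraints.lean`); the present
file supersedes it for all `a`.

* `Kerr.isVacuumConstraintSolution_data` — the constraints for `Kerr.data M a r₀ hM`, for every
  proof of the Levi-Civita hypothesis of the constraint functions;
* `Kerr.data_isVacuumConstraintSolution_holds` — **the named fact, verbatim**;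
(The same slice, packaged as a vacuum `DataEmbedding` of `Kerr.data M a r₀ hM` into the time-oriented
Kerr chart, is `Kerr.dataEmbedding`, file `KerrDataEmbedding.lean`.)

Everything is proved; no new definitions of notions, no named facts.

## References

* Y. Choquet-Bruhat, *General Relativity and the Einstein Equations*, OUP 2009, Ch. VI, Thm. 3.3.
* R. P. Kerr, A. Schild, *A new class of vacuum solutions of the Einstein field equations*, Atti
  del Convegno sulla Relatività Generale, Firenze 1965, §3.
* A. García-Parrado Gómez-Lobo, J. A. Valiente Kroon, *Kerr initial data*, J. Geom. Phys. 58
  (2008) 1186–1202, §5.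
* G. B. Cook, *Initial data for numerical relativity*, Living Rev. Relativ. 3 (2000) 5, §3.2.2.
-/

noncomputable section

open Bundle TopologicalSpace Manifold Set Module
open scoped ContDiff Topology Manifold

namespace Literature.Geometry.Lorentzian

namespace Kerr

/-! ### The constraints -/

/-- **The Kerr–Schild slice data solve the vacuum constraint equations, for every spin**: for
`M ≥ 0` and all `a, r₀`, the data `Kerr.data M a r₀ hM = ((sliceEmbed)^* g, K_ν)` satisfy
`R(h) − |k|²_h + (tr_h k)² = 0` and `div_h k − d(tr_h k) = 0` at every point of the slice — the
twice-traced Gauss and traced Codazzi equations (`InitialDataSet.isVacuumConstraintSolution_of_eq_induced`)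
for the smooth spacelike immersion `y ↦ (0, y)` with future unit normal `ν = (1 + 2H)^{-1/2} V`
(smooth lift) into the Ricci-flat Kerr–Schild chart (`Kerr.ricci_smoothMetric`), `dim E3 = 3`,
`dim E4 = 3 + 1`. Choquet-Bruhat 2009, Ch. VI, Thm. 3.3; García-Parrado–Valiente Kroon 2008, §5.
[cite: ChoquetBruhat2009, Ch. VI, Thm. 3.3] -/
theorem isVacuumConstraintSolution_data [Facts] [SliceFacts] {M : ℝ} (hM : 0 ≤ M) (a r₀ : ℝ)
    [(data M a r₀ hM).metric.HasLeviCivita] : (data M a r₀ hM).IsVacuumConstraintSolution :=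
  InitialDataSet.isVacuumConstraintSolution_of_eq_induced
    ((smoothMetric M a r₀).toPseudoRiemannianMetric) (data M a r₀ hM)
    (isSpacelikeImmersion_sliceEmbed_holds M a r₀ hM)
    (isFutureUnitNormal_sliceNormal_holds M a r₀ hM).1
    (contMDiff_sliceNormal_lift M a r₀ hM)
    (m := 3) finrank_euclideanSpace_fin finrank_euclideanSpace_fin
    (fun y ↦ ricci_smoothMetric M a r₀ (sliceEmbed a r₀ y))
    (fun y v w ↦ by rw [data_h_inner, PseudoRiemannianMetric.inducedBilin_apply])
    (fun y v w ↦ by rw [data_k, sliceK_apply])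

/-- **Discharge of the named fact `Kerr.data_isVacuumConstraintSolution`** (`KerrData.lean`,
**gr.S17**), verbatim and for all `M, a, r₀`: under its leading binder `0 ≤ M` and for every proof
of the Levi-Civita hypothesis of the constraint functions, the Kerr–Schild slice data solve the
vacuum constraint equations (`isVacuumConstraintSolution_data`). Choquet-Bruhat 2009, Ch. VI,
Thm. 3.3 (Gauss–Codazzi on a spacelike slice of the Ricci-flat Kerr metric, Kerr–Schild 1965, §3);
García-Parrado–Valiente Kroon 2008, §5. [cite: ChoquetBruhat2009, Ch. VI, Thm. 3.3] -/
theorem data_isVacuumConstraintSolution_holds [Facts] [SliceFacts] (M a r₀ : ℝ) :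
    data_isVacuumConstraintSolution M a r₀ :=
  fun hM _ ↦ isVacuumConstraintSolution_data hM a r₀

end Kerr

end Literature.Geometry.Lorentzian

end
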